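import Mathlib
import HarnessLib

/-!
# Route `FlatTubeReduction` — DEFINITION: partial products along a chain of coordinates (`chainProd`)

Seat ym-line-fcl-p3 g9 (2026-08-28).  Blueprint file «PP» for stub `stub_smearVarPosGS1` of crux `PinnedUnitStepEx` (stmt-QuantumFields-27561): the
change of variables of memo §P6.  For a configuration `x : ι → G` and a list of coordinates `[c₀, c₁, …, c_n]`, `chainProd l x` replaces `x_{c_i}` by
the PARTIAL PRODUCT `x_{c₀} x_{c₁} ⋯ x_{c_i}` (left to right), leaving all other coordinates unchanged; it is the composite of the shears
`x ↦ x[c_{i} ↦ x_{c_{i−1}} x_{c_i}]` (`…DecimationShear`), hence preserves the product Haar measure (sibling lemma file).  Route-posited kinematics;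
definition only (structural recursion on the list); nothing here proves any stub, crux or summit.
-/

set_option autoImplicit false

namespace Summit.QuantumFields.YangMills.Theorems.FlatTubeReduction.Decimation

/-- **Partial products along a chain**: `chainProd [c₀, c₁, …, c_n] x` has `c_i ↦ x_{c₀} ⋯ x_{c_i}` and agrees with `x` off the chain
(for a duplicate-free chain).  Recursion: shear the second coordinate by the first, then continue along the tail. [folklore] -/
def chainProd {ι : Type*} [DecidableEq ι] {G : Type*} [Mul G] : List ι → (ι → G) → (ι → G)
  | [], x => x
  | [_], x => x
  | a :: b :: t, x => chainProd (b :: t) (Function.update x b (x a * x b))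

end Summit.QuantumFields.YangMills.Theorems.FlatTubeReduction.Decimation
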